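import Mathlib
import Summits.ValiantsHypothesis.ValiantsHypothesis.Theses.DetQP
import Literature.Computability.AlgebraicComplexity.DeterminantalComplexityProofs
import Literature.Computability.AlgebraicComplexity.LandsbergRessayreNormalForm

/-!
# Line `vertex-power-width` — skeleton for crux `DetQP.DetqpSuperquadratic` (stmt-ValiantsHypothesis-0318)

Crux decl `Summit.ValiantsHypothesis.ValiantsHypothesis.Theses.DetQP.DetqpSuperquadratic`
(`∃ ε > 0, ∃ n₀, ∀ n ≥ n₀, (n : ℝ) ^ (2 + ε) ≤ dc(per_n)`; shared verbatim with
`Theses.UlrichPadded.Superquadratic`, routes DetQP rank 2 / UlrichPadded rank 5).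

## The line (idea card `Ideas/vertex-power-width.md`, ideator 2; triage r1: pass ×3; panel merge
`linear-homogenisation-transfer ≈ vertex-power-width ≈ regular-power-width-transfer`)

VERTEX NORMAL FORM.  Every affine determinantal expression `per_n = det A`, `A = A₀ + A₁(x)` of size
`w + 1` (`n ≥ 3`, over `ℂ`) is REGULAR — von zur Gathen: `rank A(v) ≥ w` at every point, in particular
at the cone vertex `v = 0`, so `rank A₀ = w` (PROVED in tree: `vonzurGathen1987_perm_detRepr_rank_holds`,
`isRegularDetRepr_perPoly`, `IsRegularDetRepr.exists_normalForm`).  A constant gauge therefore puts the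
expression in bordered form `[[λ, ρᵀ], [γ, 1 + L]]` with `λ, ρ, γ, L` HOMOGENEOUS LINEAR, and
`det = λ·det(1+L) − ρᵀ adj(1+L) γ` (stub 1).  Because `per_n` is HOMOGENEOUS of degree `n ≥ 3`,
comparing homogeneous components of this identity degree by degree — with the graded pieces
`B_j = Σ_{k≤j} e_k(L) (−L)^{j−k}` of `adj(1+L)` and Cayley–Hamilton beyond `j = w − 1` — kills every
correction term (stub 2):
  (A1) `λ = 0`;  (A2) `ρᵀ L^j γ = 0` for `j < n − 2`;  (A3) `ρᵀ L^{n−2} γ = (−1)^{n−1} per_n`;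
  (A4) `per_n ∣ ρᵀ L^j γ` for every `j` (all Markov parameters of the linear system `(L, γ, ρ)`).
Hence `dc(per_n) − 1` is EXACTLY the least width of a bordered matrix power `ρᵀ L^{n−2} γ` coming from a
regular expression, and the crux becomes an UNPADDED, HOMOGENEOUS, SINGLE-MATRIX width statement at
scale `n^{2+ε}` (Ikenmeyer–Landsberg 2017 Thm 4.1/Rem 4.2 could only offer `ω(n⁶)` for `himmc` through the
cubic Mahajan–Vinay dictionary).  The transfer target, sharpened as all three triagers asked ("a line
that drops the side identities is DGIJL24's `w(per)` in costume"), keeps the Krylov side identities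
(A2), (A4) as hypotheses: stub 3 = `C⁺_K` = "every Krylov-constrained power presentation of `per_n` has
width `≥ n^{2+ε}`, eventually" — the ONE open stub (the bet: same-space homogeneous GCT multiplicities /
single-matrix ABP width arguments at scale `n^{2+ε} < n⁵`, inside the Gesmundo–Landsberg open window).
Calibration: crux_ε ⇐ C⁺_K ⇐ C⁺_pure (no side identities) ⇐ `dc(per_n) ≥ n^{3+ε'}` (unroll a power
presentation to a det expression of size `(n−2)w+2`), and ¬C⁺_K i.o. would give `per_n` homogeneous
ABPs of width `< n^{2+ε}` i.o.; at `n = 3`: pure power width `3 < dc − 1 = 6` (row Laplace), so the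
inequality `dc − 1 ≥ pw` is genuinely lossy below and the side identities matter.

COMPOSITION `DetqpSuperquadratic_of : Stmt.stub_vertexGauge → Stmt.stub_gradedExpansion →
Stmt.stub_krylovWidth → DetQP.DetqpSuperquadratic` (kernel-checked, no sorry): take `ε, n₀` from stub 3
and `n ≥ max n₀ 3`; `dc(per_n)` is attained (`hasDetRepr_determinantalComplexity_holds`) and `≠ 0`
(`det` of the empty matrix is `1 ≠ per_n` by homogeneity degrees), so `dc = w + 1`; stub 1 gives the
bordered linear data, stub 2 (with `f := per_n`, `perPoly_isHomogeneous`) the identities (A2)–(A4); after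
rescaling `ρ` by the sign `(−1)^{n−1}` stub 3 yields `n^{2+ε} ≤ w ≤ w + 1 = dc(per_n)`.

## Shape (D-0027 §3.3; the skeleton audit's by-name rule)
* `Stmt.stub_…` — the three stub statements as precise `Prop`s, named like the stubs;
* `stub_…` — the same statements as sorried theorems (the REGISTERED stubs; `sorry` occurs nowhere else);
* `DetqpSuperquadratic_of` — the composition, real proof; `DetqpSuperquadratic_proof : DetqpSuperquadratic :=
  DetqpSuperquadratic_of stub_vertexGauge stub_gradedExpansion stub_krylovWidth` ties the two copies;
* the shared copy `Theses.UlrichPadded.Superquadratic` (payload route_id UlrichPadded; identical body) follows from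
  the same term — see the note at the end of the file (import omitted to limit exposure to route-file rewrites).
All three stubs are DEF-FREE: they mention only Mathlib (`MvPolynomial.IsHomogeneous`, `Matrix.det`,
`Matrix.adjugate`, `dotProduct`, `Matrix.mulVec`) and the Literature decls `perPoly`, `HasDetRepr`.
PROVED TOOLS in this file (sorry-free): `det_border` (Cauchy's bordered-determinant expansion
`det M = M₀₀ det D − ρ ⬝ᵥ (adj D *ᵥ γ)`, fixing the adjugate/sign conventions of stubs 1–2),
`isHomogeneous_one_of_totalDegree_le_one`, `exists_border_of_constPart_eq_lamMatrix` (the read-off),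
`isHomogeneous_pow_apply` / `isHomogeneous_markov` (degree bookkeeping of `m_j = ρ ⬝ᵥ (L^j *ᵥ γ)` for stubs 2–3), and
the reduction `vertexGauge_of_core : Stmt.vertexGaugeCore → Stmt.stub_vertexGauge`, so the prover of
stub 1 only owes the constant gauge `Stmt.vertexGaugeCore` (vzG + LR normal form + transposition + row scaling).

## Disproof used
`payload.disproof_path` (cdisprove v4, `run/gate/evidence/…/20260815T224454Z-Disproof.lean`) is not mounted
in this jail and no crux workfile `Cruxes/DetqpSuperquadratic/Disproof.lean` exists yet (`ledger crux cat` →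
none); its content is known from the item's evidence notes and honoured as follows.
* `superquadratic_false_without_charZero` (crux FALSE in characteristic 2): honoured — the line uses
  `char ℂ = 0` (indeed `char ≠ 2`) at `stub_vertexGauge`, through von zur Gathen regularity; in char 2
  `per = det` has the non-regular expression `A = X` (`A₀ = 0`) and stub 1 is false there, consistently.
  Stub 2 is characteristic-free algebra (stated over any commutative ring); stub 3 is over `ℂ`.
* `threshold_ge_five` (every witness has `n₀ ≥ 5`): respected — `n₀` is stub 3's, composed as `max n₀ 3`;
  nothing is claimed below it.
* `superquadratic_iff_natPow`, `dc_perPoly_mono`: available to the prover of stub 3 (cast-free form,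
  monotonicity); not needed by the composition.
* `mr_method`, `mr_method_ceiling_perPoly`, `mr_method_tight` (Hessian-rank engine exhausted at `n²/2`) and
  `perPoly_singular_on_two_zero_rows` (singular-locus engine `≤ 2n+1`), ELSW flattenings: no stub is a
  Hessian-rank, singular-locus or padded-flattening statement; stub 3 lives in the unpadded homogeneous
  model (Gesmundo–Landsberg window `w < n⁵` open; GIP17 orbit-OCCURRENCE no-go acknowledged — the bet is
  multiplicities / width, not occurrences).
* Landed Negative lemmas under `Theorems/DetqpSuperquadratic/Negative/`: none exist (2026-08-16T04Z).
* Negatives index (`ledger negatives --problem ValiantsHypothesis`: 5668, 0340, 3735, 3738): no stub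
  restates or instantiates any of them (5668 = UlrichPadded budget coordinate `j ≥ 1`, gauge-dependent;
  the vertex normal form is consistent with its Koszul-twisted Grenet witness, whose `L` is not nilpotent).
-/

namespace Summit.ValiantsHypothesis.ValiantsHypothesis.Cruxes.DetqpSuperquadratic.VertexPowerWidth

open MvPolynomial Matrix
open Literature.Computability.AlgebraicComplexity

-- `Summit.ValiantsHypothesis.ValiantsHypothesis.…` is the tree's mandated single-conjunct layout (Sub = Summit).
set_option linter.dupNamespace false

/-! ## The three stubs as precise `Prop`s -/

/-- STUB 1 — VERTEX GAUGE (provable now; size M).  Every affine determinantal expression of `per_n`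
(`n ≥ 3`, over `ℂ`) of size `w + 1` can be brought, by CONSTANT row/column operations, to bordered form
`[[λ, ρᵀ], [γ, 1 + L]]` with `λ, ρ_i, γ_i, L_ij` homogeneous linear forms, whose determinant is
`λ · det(1 + L) − ρ ⬝ᵥ (adj(1 + L) *ᵥ γ)`.
Route: `vonzurGathen1987_perm_detRepr_rank_holds` ⇒ `isRegularDetRepr_perPoly` (rank `A₀ = w`) ⇒
`IsRegularDetRepr.exists_normalForm` (`constPart (V A U) = lamMatrix ℂ i₀`, `V, U` invertible constants) ⇒
conjugate by the transposition `(0 i₀)` and divide row `0` by `det V · det U` (row `0` of `lamMatrix 0` is zero,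
so the constant part stays `diag(0, 1, …, 1)` and the determinant returns to `per_n`) ⇒ read off
`λ = A' 0 0`, `ρ j = A' 0 j.succ`, `γ i = A' i.succ 0`, `L i j = A' i.succ j.succ − δ_ij` (total degree `≤ 1`
and zero constant coefficient ⇒ homogeneous of degree 1) ⇒ bordered Laplace expansion along row `0` and
column `0` (`Matrix.det_succ_row_zero` / `det_succ_column_zero`, or `Matrix.det_fromBlocks₂₂` on the
invertible locus): `det A' = λ det(1+L) − Σ_{i,j} ρ_j adj(1+L)_{j i} γ_i`.  (`w = 0` is consistent: the
bordered formula reads `det [[λ]] = λ`; the hypothesis is in fact unsatisfiable by degrees.) -/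
def Stmt.stub_vertexGauge : Prop :=
  ∀ n : ℕ, 3 ≤ n → ∀ w : ℕ, HasDetRepr (perPoly (Fin n) ℂ) (w + 1) →
    ∃ (lam : MvPolynomial (Fin n × Fin n) ℂ) (ρ γ : Fin w → MvPolynomial (Fin n × Fin n) ℂ)
      (L : Matrix (Fin w) (Fin w) (MvPolynomial (Fin n × Fin n) ℂ)),
      lam.IsHomogeneous 1 ∧ (∀ i, (ρ i).IsHomogeneous 1) ∧ (∀ i, (γ i).IsHomogeneous 1) ∧
      (∀ i j, (L i j).IsHomogeneous 1) ∧
      lam * (1 + L).det - ρ ⬝ᵥ ((1 + L).adjugate *ᵥ γ) = perPoly (Fin n) ℂ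

/-- STUB 2 — GRADED ADJUGATE EXPANSION (provable now; size M/L; the algebra of the lever, stated for an
arbitrary homogeneous form `f` of degree `n ≥ 3` over any commutative ring — `per_n` enters only through
stub 1).  If `λ det(1+L) − ρ ⬝ᵥ (adj(1+L) *ᵥ γ) = f` with `λ, ρ, γ, L` homogeneous linear, then
(A1) `λ = 0`, (A2) the Markov parameters `m_j := ρ ⬝ᵥ (L^j *ᵥ γ)` vanish for `j < n − 2`,
(A3) `m_{n−2} = (−1)^{n−1} f`, (A4) `f ∣ m_j` for every `j`.
Route: degree-1 component gives `λ = 0` (`e₀ = 1`, every `ρᵀ B_j γ` has degree `j + 2 ≥ 2`); write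
`adj(1+L) = Σ_{j<w} B_j`, `B_j` homogeneous of degree `j`; `(1+L)·adj(1+L) = det(1+L)·1`
(`Matrix.mul_adjugate`) in degree `j` gives `B_j + L B_{j−1} = e_j(L)·1`, so `B_j = Σ_{k≤j} e_k (−L)^{j−k}`
and `b_j := ρᵀB_jγ = Σ_{k≤j} (−1)^{j−k} e_k m_{j−k}`; the degree-`(j+2)` component of the identity is
`−b_j = [j = n−2]·f`; induction on `j`: `m_j = 0` (`j < n−2`), `(−1)^n m_{n−2} = −f`, and `f ∣ m_j` for
`n−2 < j < w`; for `j ≥ w` Cayley–Hamilton (`Matrix.aeval_self_charpoly`: `L^w = −Σ_{k≥1} c_k L^{w−k}`,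
`c_k` homogeneous scalars) continues the divisibility by strong induction.  If `w < n − 1` then `f = 0`
by degrees and everything is consistent (`0 ∣ 0`).  Mathlib: `MvPolynomial.homogeneousComponent`,
`IsHomogeneous.mul/.sum`, `Matrix.adjugate`, `Matrix.charpoly`, `Matrix.aeval_self_charpoly`. -/
def Stmt.stub_gradedExpansion : Prop :=
  ∀ (K : Type) [CommRing K] (σ : Type) (n w : ℕ) (f lam : MvPolynomial σ K)
    (ρ γ : Fin w → MvPolynomial σ K) (L : Matrix (Fin w) (Fin w) (MvPolynomial σ K)),
    3 ≤ n → f.IsHomogeneous n → lam.IsHomogeneous 1 → (∀ i, (ρ i).IsHomogeneous 1) →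
    (∀ i, (γ i).IsHomogeneous 1) → (∀ i j, (L i j).IsHomogeneous 1) →
    lam * (1 + L).det - ρ ⬝ᵥ ((1 + L).adjugate *ᵥ γ) = f →
    lam = 0 ∧ (∀ j : ℕ, j < n - 2 → ρ ⬝ᵥ ((L ^ j) *ᵥ γ) = 0) ∧
      ρ ⬝ᵥ ((L ^ (n - 2)) *ᵥ γ) = (-1) ^ (n - 1) * f ∧
      (∀ j : ℕ, f ∣ ρ ⬝ᵥ ((L ^ j) *ᵥ γ))

/-- STUB 3 — KRYLOV-CONSTRAINED POWER WIDTH OF THE PERMANENT IS SUPER-QUADRATIC (the transfer target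
`C⁺_K`; OPEN — the bet of the line, hardest stub).  There is `ε > 0` such that, for all large `n`, every
presentation `per_n = ρ ⬝ᵥ (L^{n−2} *ᵥ γ)` by a `w × w` matrix `L` and vectors `ρ, γ` of homogeneous LINEAR
forms which satisfies the Krylov side identities `ρ ⬝ᵥ (L^j *ᵥ γ) = 0` (`j < n−2`) and
`per_n ∣ ρ ⬝ᵥ (L^j *ᵥ γ)` (all `j`) has `w ≥ n^{2+ε}`.  By stubs 1–2 every affine determinantal
expression of size `w + 1` yields such a presentation, so this implies the crux; conversely it is implied
by `dc(per_n) ≥ n^{3+ε'}` (a width-`w` power presentation unrolls to an expression of size `(n−2)w + 2`),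
and its failure i.o. gives homogeneous ABPs of width `< n^{2+ε}` for `per_n` i.o.  Why easier than the crux
(card §Transfer): `per_n` and the comparison variety `{ρᵀL^{n−2}γ}` (+ Krylov constraints) live in the SAME
space `Sym^n ℂ^{n²}` — no padding, no degree mismatch, ELSW does not apply, the Gesmundo–Landsberg unpadded
barrier only for `w > n⁵` — so multiplicity comparison against the invariant theory of "one vector, one
covector, one matrix" (`[S_λ(V ⊕ V* ⊕ End V)]^{GL(V)}`) is meaningful at `w = n^{2+ε}` (before the normal
form it had to be run at `w ≈ n⁶`); and the residual gauge is the feedback group `L ↦ gLg⁻¹ + γaᵀ + bρᵀ`,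
with `Z(per_n)` the preimage of the zero-transfer-function locus (all Markov parameters vanish on it, so
`per_n ∣ det[γ, Lγ, …, L^{w−1}γ]`).  First rungs the lead should aim at BEFORE the exponent (triage
sharpenings T1–T3): `w ≥ ω(n)` using (A2)/(A4), then the MR-beating `w ≥ (½+δ)n²`; today only `w ≥ n` is known
in the width model. -/
def Stmt.stub_krylovWidth : Prop :=
  ∃ ε : ℝ, 0 < ε ∧ ∃ n₀ : ℕ, ∀ n ≥ n₀, ∀ (w : ℕ) (ρ γ : Fin w → MvPolynomial (Fin n × Fin n) ℂ)
    (L : Matrix (Fin w) (Fin w) (MvPolynomial (Fin n × Fin n) ℂ)),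
    (∀ i, (ρ i).IsHomogeneous 1) → (∀ i, (γ i).IsHomogeneous 1) → (∀ i j, (L i j).IsHomogeneous 1) →
    ρ ⬝ᵥ ((L ^ (n - 2)) *ᵥ γ) = perPoly (Fin n) ℂ →
    (∀ j : ℕ, j < n - 2 → ρ ⬝ᵥ ((L ^ j) *ᵥ γ) = 0) →
    (∀ j : ℕ, perPoly (Fin n) ℂ ∣ ρ ⬝ᵥ ((L ^ j) *ᵥ γ)) →
    (n : ℝ) ^ (2 + ε) ≤ (w : ℝ)

/-! ## Registered stubs (the ONLY sorries of this file) -/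

/-- Registered stub 1 = `Stmt.stub_vertexGauge` (vertex gauge: von zur Gathen regularity ⇒ bordered
homogeneous-linear form with `det = λ det(1+L) − ρ ⬝ᵥ (adj(1+L) *ᵥ γ)`). -/
theorem stub_vertexGauge : ∀ n : ℕ, 3 ≤ n → ∀ w : ℕ, HasDetRepr (perPoly (Fin n) ℂ) (w + 1) →
    ∃ (lam : MvPolynomial (Fin n × Fin n) ℂ) (ρ γ : Fin w → MvPolynomial (Fin n × Fin n) ℂ)
      (L : Matrix (Fin w) (Fin w) (MvPolynomial (Fin n × Fin n) ℂ)),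
      lam.IsHomogeneous 1 ∧ (∀ i, (ρ i).IsHomogeneous 1) ∧ (∀ i, (γ i).IsHomogeneous 1) ∧
      (∀ i j, (L i j).IsHomogeneous 1) ∧
      lam * (1 + L).det - ρ ⬝ᵥ ((1 + L).adjugate *ᵥ γ) = perPoly (Fin n) ℂ := by
  sorry

/-- Registered stub 2 = `Stmt.stub_gradedExpansion` (graded adjugate expansion + Cayley–Hamilton:
(A1) `λ = 0`, (A2) `m_j = 0` for `j < n−2`, (A3) `m_{n−2} = (−1)^{n−1} f`, (A4) `f ∣ m_j`). -/
theorem stub_gradedExpansion : ∀ (K : Type) [CommRing K] (σ : Type) (n w : ℕ) (f lam : MvPolynomial σ K)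
    (ρ γ : Fin w → MvPolynomial σ K) (L : Matrix (Fin w) (Fin w) (MvPolynomial σ K)),
    3 ≤ n → f.IsHomogeneous n → lam.IsHomogeneous 1 → (∀ i, (ρ i).IsHomogeneous 1) →
    (∀ i, (γ i).IsHomogeneous 1) → (∀ i j, (L i j).IsHomogeneous 1) →
    lam * (1 + L).det - ρ ⬝ᵥ ((1 + L).adjugate *ᵥ γ) = f →
    lam = 0 ∧ (∀ j : ℕ, j < n - 2 → ρ ⬝ᵥ ((L ^ j) *ᵥ γ) = 0) ∧
      ρ ⬝ᵥ ((L ^ (n - 2)) *ᵥ γ) = (-1) ^ (n - 1) * f ∧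
      (∀ j : ℕ, f ∣ ρ ⬝ᵥ ((L ^ j) *ᵥ γ)) := by
  sorry

/-- Registered stub 3 = `Stmt.stub_krylovWidth` (OPEN transfer target `C⁺_K`: Krylov-constrained
single-matrix power width of `per_n` is `≥ n^{2+ε}` eventually). -/
theorem stub_krylovWidth : ∃ ε : ℝ, 0 < ε ∧ ∃ n₀ : ℕ, ∀ n ≥ n₀,
    ∀ (w : ℕ) (ρ γ : Fin w → MvPolynomial (Fin n × Fin n) ℂ)
    (L : Matrix (Fin w) (Fin w) (MvPolynomial (Fin n × Fin n) ℂ)),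
    (∀ i, (ρ i).IsHomogeneous 1) → (∀ i, (γ i).IsHomogeneous 1) → (∀ i j, (L i j).IsHomogeneous 1) →
    ρ ⬝ᵥ ((L ^ (n - 2)) *ᵥ γ) = perPoly (Fin n) ℂ →
    (∀ j : ℕ, j < n - 2 → ρ ⬝ᵥ ((L ^ j) *ᵥ γ) = 0) →
    (∀ j : ℕ, perPoly (Fin n) ℂ ∣ ρ ⬝ᵥ ((L ^ j) *ᵥ γ)) →
    (n : ℝ) ^ (2 + ε) ≤ (w : ℝ) := by
  sorry

/-! ## Proved tools of the line (sorry-free): the bordered expansion and the read-off, so that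
`stub_vertexGauge` reduces to the pure constant-gauge statement `Stmt.vertexGaugeCore` -/

private theorem sign_aux {R : Type*} [CommRing R] (i j : ℕ) (a b : R) :
    (-1 : R) ^ i * a * b = (-1) ^ j * ((-1) ^ (i + j) * b * a) := by
  rw [pow_add]
  have hj : ((-1 : R) ^ j) * (-1) ^ j = 1 := by
    rw [← pow_add, ← two_mul, pow_mul, neg_one_sq, one_pow]
  linear_combination (-((-1 : R) ^ i * b * a)) * hj

private theorem sign_aux2 {R : Type*} [CommRing R] (j : ℕ) (m x : R) :
    (-1 : R) ^ (j + 1) * m * ((-1) ^ j * x) = -(m * x) := by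
  have h : ((-1 : R) ^ (j + 1)) * (-1) ^ j = -1 := by
    rw [← pow_add]; exact Odd.neg_one_pow ⟨j, by ring⟩
  linear_combination (m * x) * h

/-- CAUCHY'S BORDERED-DETERMINANT EXPANSION (row `0`, then column `0`):
`det M = M₀₀ · det D − ρ ⬝ᵥ (adj D *ᵥ γ)`, where `D = M.submatrix succ succ` is the lower-right block,
`ρ j = M 0 j.succ` the rest of row `0` and `γ i = M i.succ 0` the rest of column `0` (Mathlib's `adjugate`
convention, `D * adjugate D = det D • 1`).  This fixes the sign/transpose conventions of stubs 1–2. -/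
theorem det_border {R : Type*} [CommRing R] {w : ℕ} (M : Matrix (Fin (w + 1)) (Fin (w + 1)) R) :
    M.det = M 0 0 * (M.submatrix Fin.succ Fin.succ).det
      - (fun j => M 0 j.succ) ⬝ᵥ ((M.submatrix Fin.succ Fin.succ).adjugate *ᵥ fun i => M i.succ 0) := by
  rw [Matrix.det_succ_row_zero, Fin.sum_univ_succ]
  simp only [Fin.val_zero, pow_zero, one_mul, Fin.succAbove_zero]
  rw [sub_eq_add_neg]
  congr 1
  cases w with
  | zero => simp [dotProduct]
  | succ w' =>
    rw [dotProduct, ← Finset.sum_neg_distrib]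
    refine Finset.sum_congr rfl fun j _ => ?_
    have h0 : j.succ.succAbove 0 = 0 := Fin.succAbove_ne_zero_zero (Fin.succ_ne_zero j)
    have hcomp : (j.succ.succAbove ∘ Fin.succ : Fin w' → Fin (w' + 1 + 1)) = Fin.succ ∘ j.succAbove := by
      funext k; simp [Fin.succ_succAbove_succ]
    have hN : (M.submatrix Fin.succ j.succ.succAbove).det
        = (-1) ^ (j : ℕ) * ((M.submatrix Fin.succ Fin.succ).adjugate *ᵥ fun i => M i.succ 0) j := by
      rw [Matrix.det_succ_column_zero, Matrix.mulVec, dotProduct, Finset.mul_sum]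
      refine Finset.sum_congr rfl fun i _ => ?_
      rw [Matrix.adjugate_fin_succ_eq_det_submatrix, Matrix.submatrix_submatrix,
        Matrix.submatrix_submatrix, hcomp, Matrix.submatrix_apply, h0]
      exact sign_aux i j _ _
    rw [hN, Fin.val_succ]
    exact sign_aux2 j _ _

/-- An affine-linear polynomial without constant term is a homogeneous linear form. -/
theorem isHomogeneous_one_of_totalDegree_le_one {R : Type*} [CommSemiring R] {σ : Type*}
    {p : MvPolynomial σ R} (hdeg : p.totalDegree ≤ 1) (h0 : coeff 0 p = 0) :
    p.IsHomogeneous 1 := by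
  intro d hd
  have hmem : d ∈ p.support := by simpa [MvPolynomial.mem_support_iff] using hd
  have hle : d.degree ≤ 1 := (MvPolynomial.le_totalDegree hmem).trans hdeg
  have hne : d ≠ 0 := by
    rintro rfl
    exact hd h0
  have hpos : d.degree ≠ 0 := by
    rwa [Ne, Finsupp.degree_eq_zero_iff]
  have key : d.degree = 1 := by omega
  rwa [Finsupp.degree_eq_weight_one] at key

/-- READ-OFF: an affine matrix whose constant part is `lamMatrix K 0 = diag(0, 1, …, 1)` is a bordered
matrix of homogeneous linear forms `[[λ, ρᵀ], [γ, 1 + L]]` (`λ = A₀₀`, `ρ j = A 0 j.succ`, `γ i = A i.succ 0`,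
`L = A.submatrix succ succ − 1`), with `det A = λ det(1+L) − ρ ⬝ᵥ (adj(1+L) *ᵥ γ)` (by `det_border`). -/
theorem exists_border_of_constPart_eq_lamMatrix {K : Type*} [CommRing K] {σ : Type*} {w : ℕ}
    (A : Matrix (Fin (w + 1)) (Fin (w + 1)) (MvPolynomial σ K))
    (hdeg : ∀ i j, (A i j).totalDegree ≤ 1) (hconst : constPart A = lamMatrix K 0) :
    ∃ (lam : MvPolynomial σ K) (ρ γ : Fin w → MvPolynomial σ K)
      (L : Matrix (Fin w) (Fin w) (MvPolynomial σ K)),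
      lam.IsHomogeneous 1 ∧ (∀ i, (ρ i).IsHomogeneous 1) ∧ (∀ i, (γ i).IsHomogeneous 1) ∧
      (∀ i j, (L i j).IsHomogeneous 1) ∧
      lam * (1 + L).det - ρ ⬝ᵥ ((1 + L).adjugate *ᵥ γ) = A.det := by
  have hc : ∀ i j, coeff 0 (A i j) = lamMatrix K (0 : Fin (w + 1)) i j := by
    intro i j
    have h := congrFun (congrFun hconst i) j
    simpa [constPart_apply, MvPolynomial.constantCoeff_eq] using h
  refine ⟨A 0 0, fun j => A 0 j.succ, fun i => A i.succ 0, A.submatrix Fin.succ Fin.succ - 1,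
    ?_, ?_, ?_, ?_, ?_⟩
  · exact isHomogeneous_one_of_totalDegree_le_one (hdeg 0 0) (by simpa using hc 0 0)
  · intro j
    refine isHomogeneous_one_of_totalDegree_le_one (hdeg 0 j.succ) ?_
    simpa [lamMatrix_apply, (Fin.succ_ne_zero j).symm] using hc 0 j.succ
  · intro i
    refine isHomogeneous_one_of_totalDegree_le_one (hdeg i.succ 0) ?_
    simpa [lamMatrix_apply, Fin.succ_ne_zero i] using hc i.succ 0
  · intro i j
    refine isHomogeneous_one_of_totalDegree_le_one ?_ ?_
    · rw [Matrix.sub_apply, Matrix.submatrix_apply]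
      refine (MvPolynomial.totalDegree_sub _ _).trans (max_le (hdeg _ _) ?_)
      rw [Matrix.one_apply]
      split_ifs <;> simp
    · rw [Matrix.sub_apply, Matrix.submatrix_apply, MvPolynomial.coeff_sub, hc, Matrix.one_apply]
      by_cases hij : i = j
      · subst hij; simp [lamMatrix_apply, Fin.succ_ne_zero]
      · simp [lamMatrix_apply, hij]
  · rw [add_sub_cancel]
    exact (det_border A).symm

/-- Entries of a power of a matrix of linear forms are homogeneous: `(L^j) i k` has degree `j`
(tool for stubs 2–3). -/
theorem isHomogeneous_pow_apply {K : Type*} [CommSemiring K] {σ : Type*} {w : ℕ}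
    (L : Matrix (Fin w) (Fin w) (MvPolynomial σ K))
    (hL : ∀ i k, (L i k).IsHomogeneous 1) (j : ℕ) (i k : Fin w) : ((L ^ j) i k).IsHomogeneous j := by
  induction j generalizing i k with
  | zero =>
    rw [pow_zero, Matrix.one_apply]
    split_ifs
    · exact isHomogeneous_one σ K
    · exact isHomogeneous_zero σ K 0
  | succ j ih =>
    rw [pow_succ, Matrix.mul_apply]
    refine IsHomogeneous.sum _ _ _ fun l _ => ?_
    exact (ih i l).mul (hL l k)

/-- The Markov parameters `m_j = ρ ⬝ᵥ (L^j *ᵥ γ)` of homogeneous linear data are homogeneous of degree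
`j + 2` (tool for stubs 2–3: the degree bookkeeping behind (A2)–(A4)). -/
theorem isHomogeneous_markov {K : Type*} [CommSemiring K] {σ : Type*} {w : ℕ}
    (ρ γ : Fin w → MvPolynomial σ K) (L : Matrix (Fin w) (Fin w) (MvPolynomial σ K))
    (hρ : ∀ i, (ρ i).IsHomogeneous 1) (hγ : ∀ i, (γ i).IsHomogeneous 1) (hL : ∀ i k, (L i k).IsHomogeneous 1)
    (j : ℕ) : (ρ ⬝ᵥ ((L ^ j) *ᵥ γ)).IsHomogeneous (j + 2) := by
  unfold dotProduct Matrix.mulVec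
  refine IsHomogeneous.sum _ _ _ fun i _ => ?_
  have h2 : ((L ^ j) i ⬝ᵥ γ).IsHomogeneous (j + 1) := by
    unfold dotProduct
    refine IsHomogeneous.sum _ _ _ fun k _ => ?_
    exact (isHomogeneous_pow_apply L hL j i k).mul (hγ k)
  have := (hρ i).mul h2
  simpa [add_comm, add_left_comm] using this

/-- The PURE GAUGE CORE of stub 1 (what remains for its prover after the read-off): every affine
determinantal expression of `per_n` (`n ≥ 3`) of size `w + 1` is constant-gauge-equivalent to one with
constant part `diag(0, 1, …, 1)` and the same determinant.  Route: `vonzurGathen1987_perm_detRepr_rank_holds`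
⇒ `isRegularDetRepr_perPoly` ⇒ `IsRegularDetRepr.exists_normalForm` (`V A U`, constant part `lamMatrix ℂ i₀`,
determinant `det V · det U · per_n`) ⇒ reindex by the transposition `Equiv.swap 0 i₀` (`Matrix.det_submatrix_equiv_self`)
⇒ multiply row `0` by `(det V · det U)⁻¹` (row `0` of `lamMatrix ℂ 0` is zero).  Not a registered stub
(it is stub 1 minus the proved read-off); provable now, size S/M. -/
def Stmt.vertexGaugeCore : Prop :=
  ∀ n : ℕ, 3 ≤ n → ∀ w : ℕ, HasDetRepr (perPoly (Fin n) ℂ) (w + 1) →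
    ∃ A : Matrix (Fin (w + 1)) (Fin (w + 1)) (MvPolynomial (Fin n × Fin n) ℂ),
      IsAffineDetRepr (perPoly (Fin n) ℂ) A ∧ constPart A = lamMatrix ℂ 0

/-- Stub 1 from its gauge core and the proved read-off. -/
theorem vertexGauge_of_core : Stmt.vertexGaugeCore → Stmt.stub_vertexGauge := by
  intro h n hn w hrep
  obtain ⟨A, hA, hconst⟩ := h n hn w hrep
  obtain ⟨lam, ρ, γ, L, h1, h2, h3, h4, hdet⟩ := exists_border_of_constPart_eq_lamMatrix A hA.1 hconst
  exact ⟨lam, ρ, γ, L, h1, h2, h3, h4, hdet.trans hA.2⟩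

/-! ## Proved glue of the line (sorry-free) -/

/-- `per_n` is homogeneous of degree `n` (tree: `perPoly_isHomogeneous`, degree `Fintype.card (Fin n)`). -/
theorem perPoly_isHomogeneous_fin (n : ℕ) : (perPoly (Fin n) ℂ).IsHomogeneous n := by
  simpa [Fintype.card_fin] using (perPoly_isHomogeneous (n := Fin n) (k := ℂ))

/-- `dc(per_n) ≠ 0` for `n ≥ 1`: the attained expression cannot be the empty determinant `1`. -/
theorem determinantalComplexity_perPoly_ne_zero {n : ℕ} (hn : 1 ≤ n) :
    determinantalComplexity (perPoly (Fin n) ℂ) ≠ 0 := by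
  intro h0
  have hatt : HasDetRepr (perPoly (Fin n) ℂ) (determinantalComplexity (perPoly (Fin n) ℂ)) :=
    hasDetRepr_determinantalComplexity_holds _
  rw [h0] at hatt
  obtain ⟨A, -, hdet⟩ := hatt
  have h1 : perPoly (Fin n) ℂ = 1 := by rw [← hdet, Matrix.det_fin_zero]
  have hh := perPoly_isHomogeneous_fin n
  rw [h1] at hh
  have := (isHomogeneous_one (Fin n × Fin n) ℂ).inj_right hh one_ne_zero
  omega

/-- Rescaling the covector by a scalar polynomial rescales every pairing `ρ ⬝ᵥ v`. -/
theorem smul_vec_dotProduct {w : ℕ} {R : Type*} [CommSemiring R] (c : R) (ρ v : Fin w → R) :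
    (fun i => c * ρ i) ⬝ᵥ v = c * (ρ ⬝ᵥ v) := by
  simp only [dotProduct, Finset.mul_sum, mul_assoc]

/-! ## The composition (kernel-checked): the three stubs prove the crux BY NAME -/

/-- **The crux from the three stubs.**  `ε, n₀` from stub 3; for `n ≥ max n₀ 3`: `dc(per_n) = w + 1` is
attained and positive; stub 1 gauges the attained expression to bordered linear data, stub 2 extracts the
Krylov identities (A2)–(A4) for `f = per_n`, the sign `(−1)^{n−1}` is absorbed into `ρ`, and stub 3 gives
`n^{2+ε} ≤ w ≤ dc(per_n)`. -/
theorem DetqpSuperquadratic_of :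
    Stmt.stub_vertexGauge → Stmt.stub_gradedExpansion → Stmt.stub_krylovWidth →
      Summit.ValiantsHypothesis.ValiantsHypothesis.Theses.DetQP.DetqpSuperquadratic := by
  intro hG hE hW
  unfold Stmt.stub_vertexGauge at hG
  unfold Stmt.stub_gradedExpansion at hE
  unfold Stmt.stub_krylovWidth at hW
  obtain ⟨ε, hε, n₀, hW⟩ := hW
  show ∃ ε : ℝ, 0 < ε ∧ ∃ n₀ : ℕ, ∀ n ≥ n₀,
    (n : ℝ) ^ (2 + ε) ≤ (determinantalComplexity (perPoly (Fin n) ℂ) : ℝ)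
  refine ⟨ε, hε, max n₀ 3, fun n hn => ?_⟩
  have hn₀ : n₀ ≤ n := le_trans (le_max_left _ _) hn
  have hn3 : 3 ≤ n := le_trans (le_max_right _ _) hn
  -- `dc(per_n) = w + 1`, attained
  obtain ⟨w, hw⟩ : ∃ w : ℕ, determinantalComplexity (perPoly (Fin n) ℂ) = w + 1 :=
    ⟨determinantalComplexity (perPoly (Fin n) ℂ) - 1,
      by have := determinantalComplexity_perPoly_ne_zero (n := n) (by omega); omega⟩
  have hatt : HasDetRepr (perPoly (Fin n) ℂ) (w + 1) := by
    rw [← hw]; exact hasDetRepr_determinantalComplexity_holds _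
  -- stub 1: vertex gauge
  obtain ⟨lam, ρ, γ, L, hlam, hρ, hγ, hL, hdet⟩ := hG n hn3 w hatt
  -- stub 2: graded expansion for `f = per_n`
  obtain ⟨-, hA2, hA3, hA4⟩ :=
    hE ℂ (Fin n × Fin n) n w (perPoly (Fin n) ℂ) lam ρ γ L hn3 (perPoly_isHomogeneous_fin n)
      hlam hρ hγ hL hdet
  -- absorb the sign `(−1)^(n−1)` into `ρ`
  have hcc : ((-1 : MvPolynomial (Fin n × Fin n) ℂ) ^ (n - 1)) * (-1) ^ (n - 1) = 1 := by
    rw [← mul_pow, neg_one_mul, neg_neg, one_pow]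
  have hc0 : ((-1 : MvPolynomial (Fin n × Fin n) ℂ) ^ (n - 1)).IsHomogeneous 0 := by
    simpa using ((isHomogeneous_one (Fin n × Fin n) ℂ).neg).pow (n - 1)
  have hρ' : ∀ i, ((fun i => (-1 : MvPolynomial (Fin n × Fin n) ℂ) ^ (n - 1) * ρ i) i).IsHomogeneous 1 := by
    intro i
    simpa using hc0.mul (hρ i)
  have h3' : (fun i => (-1 : MvPolynomial (Fin n × Fin n) ℂ) ^ (n - 1) * ρ i) ⬝ᵥ ((L ^ (n - 2)) *ᵥ γ)
      = perPoly (Fin n) ℂ := by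
    rw [smul_vec_dotProduct, hA3, ← mul_assoc, hcc, one_mul]
  have h2' : ∀ j : ℕ, j < n - 2 →
      (fun i => (-1 : MvPolynomial (Fin n × Fin n) ℂ) ^ (n - 1) * ρ i) ⬝ᵥ ((L ^ j) *ᵥ γ) = 0 := by
    intro j hj
    rw [smul_vec_dotProduct, hA2 j hj, mul_zero]
  have h4' : ∀ j : ℕ, perPoly (Fin n) ℂ ∣
      (fun i => (-1 : MvPolynomial (Fin n × Fin n) ℂ) ^ (n - 1) * ρ i) ⬝ᵥ ((L ^ j) *ᵥ γ) := by
    intro j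
    rw [smul_vec_dotProduct]
    exact Dvd.dvd.mul_left (hA4 j) _
  -- stub 3: the width bound
  have hwle := hW n hn₀ w _ γ L hρ' hγ hL h3' h2' h4'
  rw [hw]
  calc (n : ℝ) ^ (2 + ε) ≤ (w : ℝ) := hwle
    _ ≤ ((w + 1 : ℕ) : ℝ) := by exact_mod_cast Nat.le_succ w

/-- THE SKELETON: the crux, modulo exactly the three registered stubs (compiler-checks that the two
copies of each stub statement agree). -/
theorem DetqpSuperquadratic_proof :
    Summit.ValiantsHypothesis.ValiantsHypothesis.Theses.DetQP.DetqpSuperquadratic :=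
  DetqpSuperquadratic_of stub_vertexGauge stub_gradedExpansion stub_krylovWidth

/-! ## The shared copy of the crux in route UlrichPadded (same item stmt-ValiantsHypothesis-0318)
`Theses.UlrichPadded.Superquadratic` has literally the same body as `Theses.DetQP.DetqpSuperquadratic`, so a lead
working under route UlrichPadded obtains it from the same term:
`theorem Superquadratic_of : Stmt.stub_vertexGauge → Stmt.stub_gradedExpansion → Stmt.stub_krylovWidth →
Theses.UlrichPadded.Superquadratic := fun hG hE hW => DetqpSuperquadratic_of hG hE hW` (checked rc 0 on the farm
2026-08-16T04:38Z with `import …Theses.UlrichPadded`; the import is left out of the published skeleton only to halve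
its exposure to gate rewrites of route files, which make the farm transiently incoherent). -/

end Summit.ValiantsHypothesis.ValiantsHypothesis.Cruxes.DetqpSuperquadratic.VertexPowerWidth
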